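import Mathlib
import HarnessLib

/-!
# THE STUDENT BOUNDARY IS GAUSSIAN-NULL: for `a ≥ 2` i.i.d. standard Gaussians,
# `P(a · Ḡ² = z² · s²(G)) = 0` for every `z`

HONEST FRAMING: exact (Metropolis-corrected) sampling algorithms for lattice gauge theory;
figures of merit are autocorrelation/cost numbers at stated couplings and volumes; no
continuum-physics claim.

Venture `LatticeQCDFlow` (cell pub-lqcd), topic `Scoring`; FANOUT row 4 (`s0-u1-b`, GEN-32).
NEW WORK of the cell (an elementary measure-theoretic lemma), not a published result; no definition
is introduced; nothing is cited as a fact.  It is the null-boundary input of the portmanteau step in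
the Student calibration of batch-means error bars at a FIXED number of batches
(`Scoring/BatchMeansFixedBatchCount.lean`): the coverage event `{a Ḡ² ≤ z² s²(G)}` of the limit
vector `G ∼ N(0,1)^{⊗a}` (`Ḡ` the mean, `s²` the sample variance with divisor `a − 1`) is a
continuity set.  Proof: disintegrate the product Gaussian along its first coordinate
(`MeasureTheory.measurePreserving_piFinSuccAbove`, `Measure.prod_apply_symm`); for every value
`y ≠ 0` of the other `a − 1 ≥ 1` coordinates the section `{t | a m(t,y)² = z² s²(t,y)}` is the zero
set of the polynomial `((1+c)/a − c) t² + (2(1+c)R/a) t + ((1+c)R²/a − cQ)` (`c = z²/(a−1)`,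
`R = Σ y_i`, `Q = Σ y_i²`), which has a nonzero coefficient (if the first two vanish then `R = 0`
and the constant is `−cQ ≠ 0` unless `c = 0`, in which case the leading one is `1/a`), hence is
finite and Gaussian-null; `{y = 0}` is null.  Also recorded: a vector of i.i.d. `N(0,1)` coordinates
read in `EuclideanSpace` has law `stdGaussian` (Mathlib's `map_pi_eq_stdGaussian`).

## Content

* **`pi_gaussianReal_studentBoundary_eq_zero`** — `k ≥ 1`:
  `N(0,1)^{⊗(k+1)} {x | (k+1)·x̄² − z²·Σ_j (x_j − x̄)²/k = 0} = 0`;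
* `pi_gaussianReal_sumHyperplane_eq_zero` — `N(0,1)^{⊗(k'+1)} {y | Σ y_i = r} = 0`;
* **`pi_gaussianReal_twoSample_studentBoundary_eq_zero`** — `k ≥ 1`: under `N(0,1)^{⊗(k+1)} ⊗ N(0,1)^{⊗(k+1)}`,
  `{(g,h) | (k+1)(ḡ − h̄)² = z² (s²(g) + s²(h))}` is null (the TWO-CHAIN Student boundary);
* `hasLaw_toLp_of_hasLaw_pi_gaussianReal` — `G ∼ N(0,1)^{⊗a}` ⇒ `toLp 2 ∘ G ∼ stdGaussian`.

NOT CLAIMED: general quadrics / algebraic hypersurfaces (only this one); any number of ours.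
-/

noncomputable section

namespace Summit.Ventures.LatticeQCDFlow.Scoring

open MeasureTheory ProbabilityTheory Filter Finset Polynomial
open scoped ENNReal Topology

/-! ### §1 The Student boundary is null under a product Gaussian law -/

section Gaussian

/-- **THE STUDENT BOUNDARY IS NULL FOR A STANDARD GAUSSIAN VECTOR.**  For `a = k + 1 ≥ 2` i.i.d.
`N(0,1)` coordinates `x` and any `z`, the event `a · x̄² = z² · s²(x)` (`x̄ = (Σ_j x_j)/a`,
`s²(x) = Σ_j (x_j − x̄)²/(a − 1)`) has probability zero: for every value `y ≠ 0` of the other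
coordinates the section in the first coordinate is the zero set of a polynomial of degree `≤ 2` with
a nonzero coefficient (`measurePreserving_piFinSuccAbove` + `Measure.prod_apply_symm`). -/
theorem pi_gaussianReal_studentBoundary_eq_zero (k : ℕ) (hk : 1 ≤ k) (z : ℝ) :
    Measure.pi (fun _ : Fin (k + 1) => gaussianReal 0 1)
      {x : Fin (k + 1) → ℝ | ((k + 1 : ℕ) : ℝ) * ((∑ j, x j) / ((k + 1 : ℕ) : ℝ)) ^ 2
        - z ^ 2 * ((∑ j, (x j - (∑ i, x i) / ((k + 1 : ℕ) : ℝ)) ^ 2) / (((k + 1 : ℕ) : ℝ) - 1)) = 0} = 0 := by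
  have hcast : ((k + 1 : ℕ) : ℝ) = (k : ℝ) + 1 := by push_cast; ring
  have hcast' : ((k + 1 : ℕ) : ℝ) - 1 = (k : ℝ) := by rw [hcast]; ring
  simp only [hcast, add_sub_cancel_right]
  set μs : Fin (k + 1) → Measure ℝ := fun _ => gaussianReal 0 1 with hμs
  set F : (Fin (k + 1) → ℝ) → ℝ := fun x => ((k : ℝ) + 1) * ((∑ j, x j) / ((k : ℝ) + 1)) ^ 2
        - z ^ 2 * ((∑ j, (x j - (∑ i, x i) / ((k : ℝ) + 1)) ^ 2) / k) with hF
  have hFm : Measurable F := by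
    simp only [hF]
    fun_prop
  have hS : MeasurableSet {x : Fin (k + 1) → ℝ | F x = 0} := hFm (measurableSet_singleton 0)
  set e := MeasurableEquiv.piFinSuccAbove (fun _ : Fin (k + 1) => ℝ) 0 with he
  have hmp := measurePreserving_piFinSuccAbove μs 0
  have hkR : (0 : ℝ) < k := by exact_mod_cast hk
  have haR : (0 : ℝ) < (k : ℝ) + 1 := by positivity
  -- the coordinates of `e.symm (t, y) = Fin.insertNth 0 t y`
  have hsum : ∀ (t : ℝ) (y : Fin k → ℝ) (g : ℝ → ℝ),
      ∑ j, g ((e.symm (t, y)) j) = g t + ∑ i, g (y i) := by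
    intro t y g
    rw [Fin.sum_univ_succ]
    simp [he, MeasurableEquiv.piFinSuccAbove_symm_apply]
  -- the section polynomial
  set c : ℝ := z ^ 2 / k with hc
  have hc0 : 0 ≤ c := by positivity
  have hpoly : ∀ (t : ℝ) (y : Fin k → ℝ), F (e.symm (t, y))
      = ((1 + c) / ((k : ℝ) + 1) - c) * t ^ 2 + (2 * (1 + c) * (∑ i, y i) / ((k : ℝ) + 1)) * t
        + ((1 + c) * (∑ i, y i) ^ 2 / ((k : ℝ) + 1) - c * ∑ i, y i ^ 2) := by
    intro t y
    have h1 : ∑ j, (e.symm (t, y)) j = t + ∑ i, y i := by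
      simpa using hsum t y id
    have h2 : ∀ m : ℝ, ∑ j, ((e.symm (t, y)) j - m) ^ 2 = (t - m) ^ 2 + ∑ i, (y i - m) ^ 2 :=
      fun m => hsum t y (fun r => (r - m) ^ 2)
    have h3 : ∀ m : ℝ, ∑ i, (y i - m) ^ 2 = ∑ i, y i ^ 2 - 2 * m * ∑ i, y i + k * m ^ 2 := by
      intro m
      have : ∀ i, (y i - m) ^ 2 = y i ^ 2 - 2 * m * y i + m ^ 2 := fun i => by ring
      simp_rw [this, Finset.sum_add_distrib, Finset.sum_sub_distrib, Finset.mul_sum, Finset.sum_const,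
        Finset.card_univ, Fintype.card_fin, nsmul_eq_mul]
    simp only [hF]
    rw [h1, h2, h3, hc]
    field_simp
    ring
  -- for `y ≠ 0` some coefficient is nonzero
  have hcoef : ∀ y : Fin k → ℝ, y ≠ 0 →
      ((1 + c) / ((k : ℝ) + 1) - c) ≠ 0 ∨ (2 * (1 + c) * (∑ i, y i) / ((k : ℝ) + 1)) ≠ 0
        ∨ ((1 + c) * (∑ i, y i) ^ 2 / ((k : ℝ) + 1) - c * ∑ i, y i ^ 2) ≠ 0 := by
    intro y hy
    have hQ : 0 < ∑ i, y i ^ 2 := by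
      obtain ⟨i, hi⟩ : ∃ i, y i ≠ 0 := by
        by_contra h
        push Not at h
        exact hy (funext h)
      exact lt_of_lt_of_le (by positivity : 0 < y i ^ 2)
        (Finset.single_le_sum (f := fun i => y i ^ 2) (fun j _ => sq_nonneg (y j)) (Finset.mem_univ i))
    by_contra hall
    push Not at hall
    obtain ⟨hα, hβ, hγ⟩ := hall
    have hR : ∑ i, y i = 0 := by
      have h1c : (2 * (1 + c)) / ((k : ℝ) + 1) ≠ 0 := by positivity
      have : (2 * (1 + c)) / ((k : ℝ) + 1) * ∑ i, y i = 0 := by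
        rw [← hβ]; ring
      rcases mul_eq_zero.1 this with h | h
      · exact absurd h h1c
      · exact h
    rw [hR] at hγ
    have hc' : c = 0 := by
      have : c * ∑ i, y i ^ 2 = 0 := by
        have h' : (1 + c) * (0 : ℝ) ^ 2 / ((k : ℝ) + 1) = 0 := by simp
        linarith [hγ, h']
      rcases mul_eq_zero.1 this with h | h
      · exact h
      · exact absurd h hQ.ne'
    rw [hc'] at hα
    have : (1 : ℝ) / ((k : ℝ) + 1) ≠ 0 := by positivity
    exact this (by simpa using hα)
  -- transport to the product space and integrate out the other coordinates
  have hT : MeasurableSet (e.symm ⁻¹' {x : Fin (k + 1) → ℝ | F x = 0}) := e.symm.measurable hS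
  have h1 : Measure.pi μs {x : Fin (k + 1) → ℝ | F x = 0}
      = ((μs 0).prod (Measure.pi fun j => μs (Fin.succAbove 0 j)))
          (e.symm ⁻¹' {x : Fin (k + 1) → ℝ | F x = 0}) := by
    rw [← hmp.measure_preimage hT.nullMeasurableSet]
    congr 1
    ext x
    show F x = 0 ↔ F (e.symm (e x)) = 0
    rw [e.symm_apply_apply]
  rw [h1, Measure.prod_apply_symm hT]
  haveI : ∀ j : Fin k, NullSingletonClass ((fun j => μs (Fin.succAbove 0 j)) j) := fun j =>
    nullSingletonClass_gaussianReal one_ne_zero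
  haveI : Nonempty (Fin k) := ⟨⟨0, hk⟩⟩
  haveI : NullSingletonClass (μs 0) := nullSingletonClass_gaussianReal one_ne_zero
  have hν0 : ∀ᵐ y ∂(Measure.pi fun j : Fin k => μs (Fin.succAbove 0 j)), y ≠ 0 := by
    rw [ae_iff]
    have : {y : Fin k → ℝ | ¬ y ≠ 0} = {0} := by ext y; simp
    rw [this]
    exact measure_singleton _
  refine (lintegral_congr_ae (hν0.mono fun y hy => ?_)).trans lintegral_zero
  show (μs 0) ((fun t : ℝ => (t, y)) ⁻¹' (e.symm ⁻¹' {x : Fin (k + 1) → ℝ | F x = 0})) = 0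
  have hset : (fun t : ℝ => (t, y)) ⁻¹' (e.symm ⁻¹' {x : Fin (k + 1) → ℝ | F x = 0})
      = {t : ℝ | ((1 + c) / ((k : ℝ) + 1) - c) * t ^ 2 + (2 * (1 + c) * (∑ i, y i) / ((k : ℝ) + 1)) * t
        + ((1 + c) * (∑ i, y i) ^ 2 / ((k : ℝ) + 1) - c * ∑ i, y i ^ 2) = 0} := by
    ext t
    simp only [Set.mem_preimage, Set.mem_setOf_eq, hpoly t y]
  rw [hset]
  -- the section is the zero set of a polynomial of degree `≤ 2` with a nonzero coefficient: finite
  have hfin : ∀ {α β γ : ℝ}, (α ≠ 0 ∨ β ≠ 0 ∨ γ ≠ 0) → {t : ℝ | α * t ^ 2 + β * t + γ = 0}.Finite := by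
    intro α β γ h
    by_cases hαβ : α ≠ 0 ∨ β ≠ 0
    · set p : Polynomial ℝ := C α * X ^ 2 + C β * X + C γ with hp_def
      have hp : p ≠ 0 := by
        intro hp
        have h2 : p.coeff 2 = α := by simp [hp_def]
        have h1 : p.coeff 1 = β := by simp [hp_def, coeff_X_pow, coeff_C]
        rw [hp, coeff_zero] at h1 h2
        rcases hαβ with h' | h'
        · exact h' h2.symm
        · exact h' h1.symm
      refine (Polynomial.finite_setOf_isRoot hp).subset fun x hx => ?_
      simp only [Set.mem_setOf_eq] at hx ⊢
      simp [hp_def, hx]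
    · push Not at hαβ
      obtain ⟨hα, hβ⟩ := hαβ
      have hγ : γ ≠ 0 := by
        rcases h with h | h | h
        · exact absurd hα h
        · exact absurd hβ h
        · exact h
      have : {t : ℝ | α * t ^ 2 + β * t + γ = 0} = ∅ := by
        ext t
        simp [hα, hβ, hγ]
      rw [this]
      exact Set.finite_empty
  exact (hfin (hcoef y hy)).measure_zero _

/-- **A coordinate-sum hyperplane is Gaussian-null**: for `k' ≥ 0` i.i.d. `N(0,1)` coordinates on
`Fin (k'+1)` and any `r`, `N(0,1)^{⊗(k'+1)} {y | Σ_i y_i = r} = 0` (sections in the first coordinate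
are singletons). -/
theorem pi_gaussianReal_sumHyperplane_eq_zero (k' : ℕ) (r : ℝ) :
    Measure.pi (fun _ : Fin (k' + 1) => gaussianReal 0 1) {y : Fin (k' + 1) → ℝ | ∑ i, y i = r} = 0 := by
  set μs : Fin (k' + 1) → Measure ℝ := fun _ => gaussianReal 0 1 with hμs
  have hS : MeasurableSet {y : Fin (k' + 1) → ℝ | ∑ i, y i = r} :=
    measurableSet_eq_fun (by fun_prop) measurable_const
  set e := MeasurableEquiv.piFinSuccAbove (fun _ : Fin (k' + 1) => ℝ) 0 with he
  have hmp := measurePreserving_piFinSuccAbove μs 0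
  have hsum : ∀ (t : ℝ) (y : Fin k' → ℝ), ∑ j, (e.symm (t, y)) j = t + ∑ i, y i := by
    intro t y
    rw [Fin.sum_univ_succ]
    simp [he, MeasurableEquiv.piFinSuccAbove_symm_apply]
  have hT : MeasurableSet (e.symm ⁻¹' {y : Fin (k' + 1) → ℝ | ∑ i, y i = r}) := e.symm.measurable hS
  have h1 : Measure.pi μs {y : Fin (k' + 1) → ℝ | ∑ i, y i = r}
      = ((μs 0).prod (Measure.pi fun j => μs (Fin.succAbove 0 j)))
          (e.symm ⁻¹' {y : Fin (k' + 1) → ℝ | ∑ i, y i = r}) := by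
    rw [← hmp.measure_preimage hT.nullMeasurableSet]
    congr 1
    ext x
    show ∑ i, x i = r ↔ ∑ i, (e.symm (e x)) i = r
    rw [e.symm_apply_apply]
  rw [h1, Measure.prod_apply_symm hT]
  haveI : NullSingletonClass (μs 0) := nullSingletonClass_gaussianReal one_ne_zero
  refine (lintegral_congr_ae (ae_of_all _ fun y => ?_)).trans lintegral_zero
  show (μs 0) ((fun t : ℝ => (t, y)) ⁻¹' (e.symm ⁻¹' {x : Fin (k' + 1) → ℝ | ∑ i, x i = r})) = 0
  have hset : (fun t : ℝ => (t, y)) ⁻¹' (e.symm ⁻¹' {x : Fin (k' + 1) → ℝ | ∑ i, x i = r})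
      = {r - ∑ i, y i} := by
    ext t
    simp only [Set.mem_preimage, Set.mem_setOf_eq, hsum t y, Set.mem_singleton_iff]
    constructor
    · intro h; linarith
    · intro h; linarith
  rw [hset]
  exact measure_singleton _

/-- **THE TWO-SAMPLE STUDENT BOUNDARY IS NULL**: for `a = k + 1 ≥ 2`, two INDEPENDENT vectors
`g, h` of `a` i.i.d. `N(0,1)` coordinates and any `z`, the event
`a (ḡ − h̄)² = z² (s²(g) + s²(h))` has probability zero under `N(0,1)^{⊗a} ⊗ N(0,1)^{⊗a}` — for every
`h` and every value `y` of the other coordinates of `g` off a null hyperplane, the section in the first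
coordinate of `g` is the zero set of a polynomial of degree `≤ 2` with a nonzero linear coefficient. -/
theorem pi_gaussianReal_twoSample_studentBoundary_eq_zero (k : ℕ) (hk : 1 ≤ k) (z : ℝ) :
    ((Measure.pi (fun _ : Fin (k + 1) => gaussianReal 0 1)).prod
        (Measure.pi (fun _ : Fin (k + 1) => gaussianReal 0 1)))
      {p : (Fin (k + 1) → ℝ) × (Fin (k + 1) → ℝ) |
        ((k + 1 : ℕ) : ℝ) * ((∑ j, p.1 j) / ((k + 1 : ℕ) : ℝ) - (∑ j, p.2 j) / ((k + 1 : ℕ) : ℝ)) ^ 2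
          - z ^ 2 * (((∑ j, (p.1 j - (∑ i, p.1 i) / ((k + 1 : ℕ) : ℝ)) ^ 2) / (((k + 1 : ℕ) : ℝ) - 1))
            + ((∑ j, (p.2 j - (∑ i, p.2 i) / ((k + 1 : ℕ) : ℝ)) ^ 2) / (((k + 1 : ℕ) : ℝ) - 1))) = 0} = 0 := by
  obtain ⟨k', rfl⟩ := Nat.exists_eq_succ_of_ne_zero (show k ≠ 0 by omega)
  have hcast : ((k' + 1 + 1 : ℕ) : ℝ) = (k' : ℝ) + 1 + 1 := by push_cast; ring
  simp only [hcast, add_sub_cancel_right]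
  set a : ℝ := (k' : ℝ) + 1 + 1 with ha
  have haR : (0 : ℝ) < a := by rw [ha]; positivity
  have hkR : (0 : ℝ) < (k' : ℝ) + 1 := by positivity
  set μs : Fin (k' + 1 + 1) → Measure ℝ := fun _ => gaussianReal 0 1 with hμs
  set F : (Fin (k' + 1 + 1) → ℝ) × (Fin (k' + 1 + 1) → ℝ) → ℝ := fun p =>
    a * ((∑ j, p.1 j) / a - (∑ j, p.2 j) / a) ^ 2
      - z ^ 2 * (((∑ j, (p.1 j - (∑ i, p.1 i) / a) ^ 2) / ((k' : ℝ) + 1))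
        + ((∑ j, (p.2 j - (∑ i, p.2 i) / a) ^ 2) / ((k' : ℝ) + 1))) with hF
  have hFm : Measurable F := by
    simp only [hF]
    fun_prop
  have hS : MeasurableSet {p | F p = 0} := hFm (measurableSet_singleton 0)
  -- integrate over the second vector `q` first
  rw [Measure.prod_apply_symm hS]
  refine (lintegral_congr_ae (ae_of_all _ fun q => ?_)).trans lintegral_zero
  show (Measure.pi μs) ((fun v => (v, q)) ⁻¹' {p | F p = 0}) = 0
  -- the constants of the second sample
  set M : ℝ := (∑ j, q j) / a with hM
  set S₂ : ℝ := ∑ j, (q j - M) ^ 2 with hS₂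
  set c : ℝ := z ^ 2 / ((k' : ℝ) + 1) with hc
  have hc0 : 0 ≤ c := by positivity
  -- the section in the first vector, then in its first coordinate
  set G : (Fin (k' + 1 + 1) → ℝ) → ℝ := fun v =>
    a * ((∑ j, v j) / a - M) ^ 2
      - z ^ 2 * (((∑ j, (v j - (∑ i, v i) / a) ^ 2) / ((k' : ℝ) + 1)) + S₂ / ((k' : ℝ) + 1)) with hG
  have hGm : Measurable G := by
    simp only [hG]
    fun_prop
  have hsec : (fun v => (v, q)) ⁻¹' {p | F p = 0} = {v | G v = 0} := by
    ext v
    simp only [Set.mem_preimage, Set.mem_setOf_eq, hF, hG, hM, hS₂]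
  rw [hsec]
  have hSG : MeasurableSet {v : Fin (k' + 1 + 1) → ℝ | G v = 0} := hGm (measurableSet_singleton 0)
  set e := MeasurableEquiv.piFinSuccAbove (fun _ : Fin (k' + 1 + 1) => ℝ) 0 with he
  have hmp := measurePreserving_piFinSuccAbove μs 0
  have hsum : ∀ (t : ℝ) (y : Fin (k' + 1) → ℝ) (g : ℝ → ℝ),
      ∑ j, g ((e.symm (t, y)) j) = g t + ∑ i, g (y i) := by
    intro t y g
    rw [Fin.sum_univ_succ]
    simp [he, MeasurableEquiv.piFinSuccAbove_symm_apply]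
  have hpoly : ∀ (t : ℝ) (y : Fin (k' + 1) → ℝ), G (e.symm (t, y))
      = ((1 + c) / a - c) * t ^ 2 + (2 * (1 + c) * (∑ i, y i) / a - 2 * M) * t
        + ((1 + c) * (∑ i, y i) ^ 2 / a - 2 * M * (∑ i, y i) + a * M ^ 2 - c * (∑ i, y i ^ 2) - c * S₂) := by
    intro t y
    have h1 : ∑ j, (e.symm (t, y)) j = t + ∑ i, y i := by simpa using hsum t y id
    have h2 : ∀ m : ℝ, ∑ j, ((e.symm (t, y)) j - m) ^ 2 = (t - m) ^ 2 + ∑ i, (y i - m) ^ 2 :=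
      fun m => hsum t y (fun r => (r - m) ^ 2)
    have h3 : ∀ m : ℝ, ∑ i, (y i - m) ^ 2 = ∑ i, y i ^ 2 - 2 * m * ∑ i, y i + ((k' : ℝ) + 1) * m ^ 2 := by
      intro m
      have : ∀ i, (y i - m) ^ 2 = y i ^ 2 - 2 * m * y i + m ^ 2 := fun i => by ring
      simp_rw [this, Finset.sum_add_distrib, Finset.sum_sub_distrib, Finset.mul_sum, Finset.sum_const,
        Finset.card_univ, Fintype.card_fin, nsmul_eq_mul]
      push_cast
      ring
    simp only [hG]
    rw [h1, h2, h3, hc, ha]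
    field_simp
    ring
  -- transport to `ℝ × (Fin (k'+1) → ℝ)` and integrate out the other coordinates `y`
  have hT : MeasurableSet (e.symm ⁻¹' {v : Fin (k' + 1 + 1) → ℝ | G v = 0}) := e.symm.measurable hSG
  have h1 : Measure.pi μs {v : Fin (k' + 1 + 1) → ℝ | G v = 0}
      = ((μs 0).prod (Measure.pi fun j => μs (Fin.succAbove 0 j)))
          (e.symm ⁻¹' {v : Fin (k' + 1 + 1) → ℝ | G v = 0}) := by
    rw [← hmp.measure_preimage hT.nullMeasurableSet]
    congr 1
    ext x
    show G x = 0 ↔ G (e.symm (e x)) = 0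
    rw [e.symm_apply_apply]
  rw [h1, Measure.prod_apply_symm hT]
  haveI : NullSingletonClass (μs 0) := nullSingletonClass_gaussianReal one_ne_zero
  -- off the hyperplane `(1 + c) Σ y = a M` the linear coefficient is nonzero
  have hnull : (Measure.pi fun j : Fin (k' + 1) => μs (Fin.succAbove 0 j))
      {y : Fin (k' + 1) → ℝ | ∑ i, y i = a * M / (1 + c)} = 0 :=
    pi_gaussianReal_sumHyperplane_eq_zero k' (a * M / (1 + c))
  have hae : ∀ᵐ y ∂(Measure.pi fun j : Fin (k' + 1) => μs (Fin.succAbove 0 j)),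
      ∑ i, y i ≠ a * M / (1 + c) := by
    rw [ae_iff]
    simpa using hnull
  refine (lintegral_congr_ae (hae.mono fun y hy => ?_)).trans lintegral_zero
  show (μs 0) ((fun t : ℝ => (t, y)) ⁻¹' (e.symm ⁻¹' {v : Fin (k' + 1 + 1) → ℝ | G v = 0})) = 0
  have hset : (fun t : ℝ => (t, y)) ⁻¹' (e.symm ⁻¹' {v : Fin (k' + 1 + 1) → ℝ | G v = 0})
      = {t : ℝ | ((1 + c) / a - c) * t ^ 2 + (2 * (1 + c) * (∑ i, y i) / a - 2 * M) * t
        + ((1 + c) * (∑ i, y i) ^ 2 / a - 2 * M * (∑ i, y i) + a * M ^ 2 - c * (∑ i, y i ^ 2) - c * S₂) = 0} := by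
    ext t
    simp only [Set.mem_preimage, Set.mem_setOf_eq, hpoly t y]
  rw [hset]
  set α' : ℝ := (1 + c) / a - c with hα'
  set β' : ℝ := 2 * (1 + c) * (∑ i, y i) / a - 2 * M with hβ'
  set γ' : ℝ := (1 + c) * (∑ i, y i) ^ 2 / a - 2 * M * (∑ i, y i) + a * M ^ 2 - c * (∑ i, y i ^ 2) - c * S₂
    with hγ'
  have hβ : β' ≠ 0 := by
    intro h0
    apply hy
    have h1c : (0 : ℝ) < 1 + c := by linarith
    have h2 : 2 * (1 + c) * (∑ i, y i) / a = 2 * M := by rw [hβ'] at h0; linarith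
    have h3 := (div_eq_iff haR.ne').1 h2
    rw [eq_div_iff h1c.ne']
    linarith
  clear_value α' β' γ'
  -- a polynomial of degree `≤ 2` with nonzero linear coefficient has finitely many zeros
  set p : Polynomial ℝ := C α' * X ^ 2 + C β' * X + C γ' with hp_def
  have hp : p ≠ 0 := by
    intro hp
    have h1 : p.coeff 1 = β' := by simp [hp_def, coeff_X_pow, coeff_C]
    rw [hp, coeff_zero] at h1
    exact hβ h1.symm
  refine ((Polynomial.finite_setOf_isRoot hp).subset fun x hx => ?_).measure_zero _
  simp only [Set.mem_setOf_eq] at hx ⊢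
  simp [hp_def, hx]

/-- A vector of i.i.d. `N(0,1)` coordinates, read in `EuclideanSpace`, is `stdGaussian`. -/
theorem hasLaw_toLp_of_hasLaw_pi_gaussianReal {a : ℕ} {Ω' : Type*} [MeasurableSpace Ω']
    {P' : Measure Ω'} {G : Ω' → (Fin a → ℝ)}
    (hG : HasLaw G (Measure.pi fun _ : Fin a => gaussianReal 0 1) P') :
    HasLaw (fun ω => (WithLp.toLp 2 (G ω) : EuclideanSpace ℝ (Fin a)))
      (stdGaussian (EuclideanSpace ℝ (Fin a))) P' := by
  refine ⟨(WithLp.measurable_toLp 2 _).comp_aemeasurable hG.aemeasurable, ?_⟩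
  rw [show (fun ω => (WithLp.toLp 2 (G ω) : EuclideanSpace ℝ (Fin a))) = (WithLp.toLp 2) ∘ G from rfl,
    ← AEMeasurable.map_map_of_aemeasurable (WithLp.measurable_toLp 2 _).aemeasurable hG.aemeasurable,
    hG.map_eq, map_pi_eq_stdGaussian]

end Gaussian


end Summit.Ventures.LatticeQCDFlow.Scoring

end
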